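import Literature.NumberTheory.GaloisRepresentations.PresentationLayerTransport
import Literature.NumberTheory.GaloisRepresentations.GaloisCohomologyLayerInflationSplitting
import Literature.Algebra.Homology.DiscreteRepLayerColimitDesc
import HarnessLib

/-!
# `Ext¹_{C_Γ}(ℤ, M) → H¹(K, M)` by descent of the layer inflations (Serre CG I §2.2 Prop. 8 in degree one):
# an explicit additive bijection compatible with door-c4's `inflG` and the cocycle formula `σ ↦ γ(σ̄)`

Topic `NumberTheory/GaloisRepresentations`; namespace `Literature.NumberTheory.GaloisRepresentations.ExtOneDescent`.
Definitions with bodies (`inflateLayerCocycle`, `layerInfOne`, `extOneToH1`) and theorems; no named fact, no instance,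
no notation, no `sorry`.  Cell `bsd-schneider-ideate`, seat door-c4 gen 18; written for the (R4) bridge
`nat : H¹(K, M^{DD}) ≅ Ext¹_{C_Γ}(ℤ, S.X₃)` of the `Ш²`-readout road to `poitouTate_sha_tateDual`
(`PoitouTateShaTwoReadout.poitouTate_sha_tateDual_of_localGlobal`, hypothesis `hR4`).

THE MATHEMATICS.  For a discrete `Γ_K`-module `M` (`ρ : DiscreteGaloisModule K M`, `X = ofDiscreteGaloisModule ρ` in
door-c4's `C_Γ = DiscreteRepCat ℤ Γ_K`) and a finite Galois layer `E ⊆ K̄` (`E : GalLayer K`, `U_E = Gal(K̄/E)`), the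
inflation `H¹(Γ_K ⧸ U_E, M^{U_E}) → H¹(K, M)` (Mathlib `groupCohomology` of the layer → continuous cochains) is
`layerInfOne K ρ E := infOneLayer K E ρ ∘ toAbsLayerOf E ρ 1` (door-c6 g18's transport to the `absGaloisFixingSubgroup`
currency followed by the tree's `infOneLayer`); its cocycle formula is `[γ] ↦ [σ ↦ γ(σ̄)]` (`layerInfOne_H1π`,
`inflateLayerCocycle_apply`).  The family `E ↦ layerInfOne K ρ E` is injective (inflation–restriction,
`layerInfOne_injective`), compatible with the transitions `stepG` of door-c4's colimit
(`isCompatibleFamily_layerInfOne`) and jointly surjective for finite `M` (`exists_layerInfOne_eq`: every continuous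
class is inflated from a layer, `exists_infOneLayer_eq`).  Door-c4's `LayerColimit.desc` therefore descends it to
**`extOneToH1 K ρ : Ext¹_{C_Γ}(ℤ, X) →+ H¹(K, M)`** with `extOneToH1 (inflG U_E c) = layerInfOne E c` (`extOneToH1_inflG`)
and **`extOneToH1` is bijective** for finite `M` (`extOneToH1_bijective`).  (The tree's abstract comparison
`DiscreteRep.extTrivAddEquivGaloisCohomology ρ 1` is another such bijection; its compatibility with `inflG` is not
proved in the tree, which is why the explicit descent is recorded here.)

HONEST FRAMING: bookkeeping (Serre's `H¹(Γ, M) = lim→ H¹(Γ/U, M^U)` made explicit); no arithmetic, no case of BSD or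
of Poitou–Tate.

## References
* J.-P. Serre, *Galois Cohomology* (1997), I §2.2 Proposition 8 and Corollary 1. [SerreGaloisCohomology1997]
* J. Neukirch, A. Schmidt, K. Wingberg, *Cohomology of Number Fields* (2nd ed. 2008), (1.5.1), (1.6.7). [NeukirchSchmidtWingberg2008]
-/

noncomputable section

open CategoryTheory groupCohomology Field Function
open Literature.Algebra.Homology Literature.Algebra.Homology.DiscreteRep
open scoped ContRepresentation

namespace Literature.NumberTheory.GaloisRepresentations

namespace ExtOneDescent

open LayerDelta IdeleClassBar

variable (K : Type) [Field K]
variable {M : Type} [AddCommGroup M] [TopologicalSpace M] [DiscreteTopology M] (ρ : DiscreteGaloisModule K M)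

/-! ## §1 The layer inflation in degree one, in door-c4's currency -/

section Layer

variable (E : GalLayer K)

/-- **The inflated continuous crossed homomorphism `σ ↦ γ(σ̄)`** of a `1`-cocycle `γ` of the layer `Γ_K ⧸ U_E` with
values in `M^{U_E}` (door-c4's `invariantsQuotFunctor` currency). [cite: SerreGaloisCohomology1997, I §2.2] -/
def inflateLayerCocycle
    (γ : cocycles₁ ((invariantsQuotFunctor ℤ (E.openNormalSubgroup : Subgroup (absoluteGaloisGroup K))).obj
      (ofDiscreteGaloisModule ρ))) : contOneCocycles ρ.toTopRep :=
  haveI := normal_layer E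
  haveI := finiteDimensional_layer E
  inflateOneCocycle K E.1 ρ (mapCocycles₁ (quotEquivAbs E).toMonoidHom (toAbsLayerHomOf E ρ) γ)

/-- Unfolding: `inflateLayerCocycle γ σ = γ(σ̄)` in `M`. [cite: SerreGaloisCohomology1997, I §2.2] -/
@[simp] theorem inflateLayerCocycle_apply
    (γ : cocycles₁ ((invariantsQuotFunctor ℤ (E.openNormalSubgroup : Subgroup (absoluteGaloisGroup K))).obj
      (ofDiscreteGaloisModule ρ))) (σ : absoluteGaloisGroup K) :
    (inflateLayerCocycle K ρ E γ).1 σ = (γ (QuotientGroup.mk σ)).1 := rfl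

/-- **The layer inflation `H¹(Γ_K ⧸ U_E, M^{U_E}) →+ H¹(K, M)`** (door-c6's transport `toAbsLayerOf E ρ 1` followed by the
tree's `infOneLayer K E ρ`). [cite: SerreGaloisCohomology1997, I §2.2 Proposition 8][cite: NeukirchSchmidtWingberg2008, (1.5.1)] -/
def layerInfOne :
    groupCohomology ((invariantsQuotFunctor ℤ (E.openNormalSubgroup : Subgroup (absoluteGaloisGroup K))).obj
      (ofDiscreteGaloisModule ρ)) 1 →+ galoisCohomology ρ 1 :=
  haveI := normal_layer E
  haveI := finiteDimensional_layer E
  (infOneLayer K E.1 ρ).comp (toAbsLayerOf E ρ 1).hom.toAddMonoidHom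

/-- **Cocycle formula: `layerInfOne E [γ] = [σ ↦ γ(σ̄)]`.** [cite: SerreGaloisCohomology1997, I §2.2 Proposition 8] -/
theorem layerInfOne_H1π
    (γ : cocycles₁ ((invariantsQuotFunctor ℤ (E.openNormalSubgroup : Subgroup (absoluteGaloisGroup K))).obj
      (ofDiscreteGaloisModule ρ))) :
    layerInfOne K ρ E (H1π _ γ) = oneCocycleClass ρ.toTopRep (inflateLayerCocycle K ρ E γ) := by
  haveI := normal_layer E
  haveI := finiteDimensional_layer E
  change infOneLayer K E.1 ρ (toAbsLayerOf E ρ 1 (H1π _ γ)) = _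
  rw [toAbsLayerOf_H1π, infOneLayer_H1π]
  rfl

/-- **The layer inflation in degree one is injective** (a crossed homomorphism `σ ↦ γ(σ̄)` which is principal,
`= σ v - v`, has `v ∈ M^{U_E}` and `γ = ∂v` on the layer). [cite: SerreGaloisCohomology1997, I §2.6 (b)]
[cite: NeukirchSchmidtWingberg2008, (1.6.7)] -/
theorem layerInfOne_injective : Injective (layerInfOne K ρ E) := by
  refine (injective_iff_map_eq_zero _).2 fun c hc => ?_
  induction c using H1_induction_on with
  | h γ =>
    rw [layerInfOne_H1π] at hc
    obtain ⟨v, hv⟩ := (oneCocycleClass_eq_zero_iff _ _).1 hc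
    have hv' : ∀ σ : absoluteGaloisGroup K, (γ (QuotientGroup.mk σ)).1 = ρ σ v - v := fun σ => by
      rw [← inflateLayerCocycle_apply K ρ E γ σ]; exact hv σ
    have hvU : v ∈ Representation.invariants
        ((ofDiscreteGaloisModule ρ).obj.ρ.comp (E.openNormalSubgroup : Subgroup (absoluteGaloisGroup K)).subtype) := by
      intro u
      have h1 := hv' u.1
      rw [(QuotientGroup.eq_one_iff u.1).2 u.2, cocycles₁_map_one] at h1
      have h2 : (ρ u.1) v - v = 0 := h1.symm
      exact sub_eq_zero.1 h2
    refine (H1π_eq_zero_iff γ).2 ⟨⟨v, hvU⟩, funext fun q => ?_⟩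
    induction q using QuotientGroup.induction_on with
    | H σ =>
      apply Subtype.ext
      rw [d₀₁_hom_apply, hv' σ]
      rfl

end Layer

/-! ## §2 Joint surjectivity and compatibility of the family -/

section Family

variable (E : GalLayer K)

/-- `M^{Γ_E} → M^{U_E}`, the identity of underlying vectors (inverse to door-c6's `toAbsLayerAddHomOf`; `Γ_E = U_E` as
subgroups). [cite: SerreGaloisCohomology1997, I §2.2] -/
def ofAbsLayerAddHomOf [Normal K E.1] :
    (absGaloisLayerRep K E.1 ρ).V →+
      ((invariantsQuotFunctor ℤ (E.openNormalSubgroup : Subgroup (absoluteGaloisGroup K))).obj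
        (ofDiscreteGaloisModule ρ)).V :=
  AddMonoidHom.mk' (fun w => ⟨(w.1 : M), fun u => w.2 ⟨u.1, mem_absGaloisFixingSubgroup_of_mem E u.2⟩⟩) fun _ _ => rfl

/-- Unfolding. [cite: SerreGaloisCohomology1997, I §2.2] -/
@[simp] theorem ofAbsLayerAddHomOf_apply_coe [Normal K E.1] (w : (absGaloisLayerRep K E.1 ρ).V) :
    ((ofAbsLayerAddHomOf K ρ E w).1 : M) = w.1 := rfl

/-- Unfolding: the action of `[σ]` on `w ∈ M^{U_E}` (door-c4's layer module) is `ρ σ w`.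
[cite: SerreGaloisCohomology1997, I §2.2] -/
theorem invariantsLayer_ρ_mk_apply_coe (σ : absoluteGaloisGroup K)
    (w : ((invariantsQuotFunctor ℤ (E.openNormalSubgroup : Subgroup (absoluteGaloisGroup K))).obj
      (ofDiscreteGaloisModule ρ)).V) :
    (((((invariantsQuotFunctor ℤ (E.openNormalSubgroup : Subgroup (absoluteGaloisGroup K))).obj
      (ofDiscreteGaloisModule ρ)).ρ (QuotientGroup.mk σ)) w).1 : M) = ρ σ w.1 := rfl

/-- `(quotEquivAbs E)⁻¹ [σ] = [σ]`. [cite: SerreGaloisCohomology1997, I §2.2] -/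
theorem quotEquivAbs_symm_mk [Normal K E.1] (σ : absoluteGaloisGroup K) :
    (quotEquivAbs E).symm (QuotientGroup.mk σ) = QuotientGroup.mk σ :=
  (MulEquiv.symm_apply_eq _).2 (quotEquivAbs_mk E σ).symm

/-- Equivariance of `ofAbsLayerAddHomOf` (identity of vectors; both actions are `ρ σ`).
[cite: SerreGaloisCohomology1997, I §2.2] -/
theorem ofAbsLayerAddHomOf_ρ [Normal K E.1] (σ : absoluteGaloisGroup K) (w : (absGaloisLayerRep K E.1 ρ).V) :
    ofAbsLayerAddHomOf K ρ E ((absGaloisLayerRep K E.1 ρ).ρ (QuotientGroup.mk σ) w) =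
      ((invariantsQuotFunctor ℤ (E.openNormalSubgroup : Subgroup (absoluteGaloisGroup K))).obj
        (ofDiscreteGaloisModule ρ)).ρ (QuotientGroup.mk σ) (ofAbsLayerAddHomOf K ρ E w) := by
  apply Subtype.ext
  rw [ofAbsLayerAddHomOf_apply_coe, invariantsLayer_ρ_mk_apply_coe, ofAbsLayerAddHomOf_apply_coe,
    layerRep_ρ_mk_apply_coe]

-- the rewrites along `(quotEquivAbs E)⁻¹ [σ] = [σ]` in the layer-module goal are slow (instance unfolding of `Γ_K ⧸ U_E`)
set_option maxHeartbeats 800000 in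
/-- The transported function `q ↦ φ((quotEquivAbs E)⁻¹ q)` of a `1`-cocycle `φ` of the `absGaloisFixingSubgroup`-layer
is a `1`-cocycle of door-c4's layer. [cite: SerreGaloisCohomology1997, I §2.2 Proposition 8] -/
theorem transport_mem_cocycles₁ [Normal K E.1] (φ : cocycles₁ (absGaloisLayerRep K E.1 ρ)) :
    (fun q => ofAbsLayerAddHomOf K ρ E (φ ((quotEquivAbs E).symm q))) ∈
      cocycles₁ ((invariantsQuotFunctor ℤ (E.openNormalSubgroup : Subgroup (absoluteGaloisGroup K))).obj
        (ofDiscreteGaloisModule ρ)) := by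
  refine (mem_cocycles₁_iff _).2 fun a b => ?_
  induction a using QuotientGroup.induction_on with
  | H σ =>
    induction b using QuotientGroup.induction_on with
    | H τ =>
      have e2 : (quotEquivAbs E).symm ((QuotientGroup.mk σ : absoluteGaloisGroup K ⧸
          (E.openNormalSubgroup : Subgroup (absoluteGaloisGroup K))) * QuotientGroup.mk τ) =
          QuotientGroup.mk (σ * τ) := (MulEquiv.symm_apply_eq _).2 rfl
      have hφ := congrArg Subtype.val ((mem_cocycles₁_iff φ).1 φ.2 (QuotientGroup.mk σ) (QuotientGroup.mk τ))
      rw [← QuotientGroup.mk_mul, Submodule.coe_add, layerRep_ρ_mk_apply_coe] at hφ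
      apply Subtype.ext
      dsimp only
      simp only [e2, quotEquivAbs_symm_mk]
      exact hφ

/-- The transported `1`-cocycle. [cite: SerreGaloisCohomology1997, I §2.2 Proposition 8] -/
def transportCocycle₁ [Normal K E.1] (φ : cocycles₁ (absGaloisLayerRep K E.1 ρ)) :
    cocycles₁ ((invariantsQuotFunctor ℤ (E.openNormalSubgroup : Subgroup (absoluteGaloisGroup K))).obj
      (ofDiscreteGaloisModule ρ)) :=
  ⟨fun q => ofAbsLayerAddHomOf K ρ E (φ ((quotEquivAbs E).symm q)), transport_mem_cocycles₁ K ρ E φ⟩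

/-- Unfolding. [cite: SerreGaloisCohomology1997, I §2.2] -/
@[simp] theorem transportCocycle₁_apply [Normal K E.1] (φ : cocycles₁ (absGaloisLayerRep K E.1 ρ))
    (q : absoluteGaloisGroup K ⧸ (E.openNormalSubgroup : Subgroup (absoluteGaloisGroup K))) :
    transportCocycle₁ K ρ E φ q = ofAbsLayerAddHomOf K ρ E (φ ((quotEquivAbs E).symm q)) := rfl

/-- `toAbsLayerOf` undoes the transport: `mapCocycles₁ (quotEquivAbs E) (toAbsLayerHomOf E ρ) (transportCocycle₁ φ) = φ`.
[cite: SerreGaloisCohomology1997, I §2.2 Proposition 8] -/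
theorem mapCocycles₁_transportCocycle₁ [Normal K E.1] (φ : cocycles₁ (absGaloisLayerRep K E.1 ρ)) :
    mapCocycles₁ (quotEquivAbs E).toMonoidHom (toAbsLayerHomOf E ρ) (transportCocycle₁ K ρ E φ) = φ := by
  refine cocycles₁_ext fun q => Subtype.ext ?_
  rw [coe_mapCocycles₁]
  change ((toAbsLayerHomOf E ρ).hom (transportCocycle₁ K ρ E φ ((quotEquivAbs E) q))).1 = (φ q).1
  rw [toAbsLayerHomOf_apply_coe, transportCocycle₁_apply, ofAbsLayerAddHomOf_apply_coe, MulEquiv.symm_apply_apply]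

/-- Every `1`-cocycle class of the `absGaloisFixingSubgroup`-layer is the transport of one of door-c4's layer.
[cite: SerreGaloisCohomology1997, I §2.2 Proposition 8] -/
theorem toAbsLayerOf_one_surjective [Normal K E.1] (y : groupCohomology (absGaloisLayerRep K E.1 ρ) 1) :
    ∃ c : groupCohomology ((invariantsQuotFunctor ℤ (E.openNormalSubgroup : Subgroup (absoluteGaloisGroup K))).obj
      (ofDiscreteGaloisModule ρ)) 1, toAbsLayerOf E ρ 1 c = y := by
  induction y using H1_induction_on with
  | h φ =>
    exact ⟨H1π _ (transportCocycle₁ K ρ E φ),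
      (toAbsLayerOf_H1π E ρ _).trans (congrArg (H1π _) (mapCocycles₁_transportCocycle₁ K ρ E φ))⟩

/-- **Every class of `H¹(K, M)` (finite `M`) is inflated from some layer above any given one.**
[cite: SerreGaloisCohomology1997, I §2.2 Corollary 1 to Proposition 8] -/
theorem exists_layerInfOne_eq [Finite M] (L : GalLayer K) (x : galoisCohomology ρ 1) :
    ∃ (E : GalLayer K) (_ : L ≤ E) (c : groupCohomology ((invariantsQuotFunctor ℤ
      (E.openNormalSubgroup : Subgroup (absoluteGaloisGroup K))).obj (ofDiscreteGaloisModule ρ)) 1),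
      layerInfOne K ρ E c = x := by
  obtain ⟨E₁, hfd, hgal, y, hy⟩ := exists_infOneLayer_eq K ρ x
  haveI := hfd
  haveI := hgal
  obtain ⟨E, hLE, hE₁E⟩ := GalLayer.exists_ge_ge L ⟨E₁, hfd, hgal⟩
  haveI := normal_layer E
  haveI := finiteDimensional_layer E
  obtain ⟨y', hy'⟩ := range_infOneLayer_mono K E₁ E.1 ρ hE₁E ⟨y, hy⟩
  obtain ⟨c, hc⟩ := toAbsLayerOf_one_surjective K ρ E y'
  refine ⟨E, hLE, c, ?_⟩
  rw [← hy', ← hc]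
  rfl

variable [NumberField K]

/-- **The layer inflations form a compatible family on the cofinal family `E ↦ U_E`** of open normal subgroups of
`Γ_K` (compatibility with door-c4's transitions `stepG`: both sides are `[σ ↦ γ(σ̄)]`).
[cite: SerreGaloisCohomology1997, I §2.2 Proposition 8] -/
theorem isCompatibleFamily_layerInfOne :
    LayerColimit.IsCompatibleFamily (fun E : GalLayer K => E.openNormalSubgroup) (ofDiscreteGaloisModule ρ) 1
      (fun E => layerInfOne K ρ E) := by
  refine ⟨fun W => ⟨GalLayer.ofOpenNormalSubgroup W, ?_⟩, fun E E' h c => ?_⟩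
  · rw [GalLayer.openNormalSubgroup_ofOpenNormalSubgroup]
  · induction c using H1_induction_on with
    | h γ =>
      change layerInfOne K ρ E' (groupCohomology.map _ _ 1 (H1π _ γ)) = _
      rw [H1π_comp_map_apply, layerInfOne_H1π, layerInfOne_H1π]
      exact congrArg (oneCocycleClass _) (Subtype.ext (ContinuousMap.ext fun σ => rfl))

end Family

/-! ## §3 The descent `extOneToH1 : Ext¹_{C_Γ}(ℤ, X) →+ H¹(K, M)` and its bijectivity -/

section Descent

variable [NumberField K]

/-- **`Ext¹_{C_Γ}(ℤ, M) →+ H¹(K, M)`**: door-c4's descent (`LayerColimit.desc`) of the compatible family of layer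
inflations. [cite: SerreGaloisCohomology1997, I §2.2 Proposition 8] -/
def extOneToH1 : Abelian.Ext (triv (Γ := absoluteGaloisGroup K) ℤ) (ofDiscreteGaloisModule ρ) 1 →+ galoisCohomology ρ 1 :=
  haveI := absoluteGaloisGroup_compactSpace K
  LayerColimit.desc (fun E : GalLayer K => E.openNormalSubgroup) (ofDiscreteGaloisModule ρ) 1
    (fun E => layerInfOne K ρ E) (isCompatibleFamily_layerInfOne K ρ)

/-- **`extOneToH1 (Inf_E c) = layerInfOne E c`** on a class inflated from the layer `E`.
[cite: SerreGaloisCohomology1997, I §2.2 Proposition 8] -/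
theorem extOneToH1_inflG (E : GalLayer K)
    (c : groupCohomology ((invariantsQuotFunctor ℤ (E.openNormalSubgroup : Subgroup (absoluteGaloisGroup K))).obj
      (ofDiscreteGaloisModule ρ)) 1) :
    extOneToH1 K ρ (LayerColimit.inflG E.openNormalSubgroup (ofDiscreteGaloisModule ρ) 1 c) = layerInfOne K ρ E c :=
  haveI := absoluteGaloisGroup_compactSpace K
  LayerColimit.desc_inflG (isCompatibleFamily_layerInfOne K ρ) E c

/-- **Cocycle formula: `extOneToH1 (Inf_E [γ]) = [σ ↦ γ(σ̄)]`.** [cite: SerreGaloisCohomology1997, I §2.2 Proposition 8] -/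
theorem extOneToH1_inflG_H1π (E : GalLayer K)
    (γ : cocycles₁ ((invariantsQuotFunctor ℤ (E.openNormalSubgroup : Subgroup (absoluteGaloisGroup K))).obj
      (ofDiscreteGaloisModule ρ))) :
    extOneToH1 K ρ (LayerColimit.inflG E.openNormalSubgroup (ofDiscreteGaloisModule ρ) 1 (H1π _ γ)) =
      oneCocycleClass ρ.toTopRep (inflateLayerCocycle K ρ E γ) := by
  rw [extOneToH1_inflG, layerInfOne_H1π]

/-- **`extOneToH1 : Ext¹_{C_Γ}(ℤ, M) → H¹(K, M)` is bijective** for finite `M` (injective layer inflations, jointly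
surjective). [cite: SerreGaloisCohomology1997, I §2.2 Proposition 8 and Corollary 1] -/
theorem extOneToH1_bijective [Finite M] : Bijective (extOneToH1 K ρ) := by
  haveI := absoluteGaloisGroup_compactSpace K
  refine LayerColimit.desc_bijective (isCompatibleFamily_layerInfOne K ρ) (fun E => layerInfOne_injective K ρ E)
    fun x => ?_
  obtain ⟨E, -, c, hc⟩ := exists_layerInfOne_eq K ρ (GalLayer.bot K) x
  exact ⟨E, c, hc⟩

/-- **The inverse bijection as an additive equivalence `Ext¹_{C_Γ}(ℤ, M) ≃+ H¹(K, M)`.**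
[cite: SerreGaloisCohomology1997, I §2.2 Proposition 8] -/
def extOneEquivH1 [Finite M] : Abelian.Ext (triv (Γ := absoluteGaloisGroup K) ℤ) (ofDiscreteGaloisModule ρ) 1 ≃+ galoisCohomology ρ 1 :=
  AddEquiv.ofBijective (extOneToH1 K ρ) (extOneToH1_bijective K ρ)

/-- Unfolding. [cite: SerreGaloisCohomology1997, I §2.2 Proposition 8] -/
@[simp] theorem extOneEquivH1_apply [Finite M] (y : Abelian.Ext (triv (Γ := absoluteGaloisGroup K) ℤ) (ofDiscreteGaloisModule ρ) 1) :
    extOneEquivH1 K ρ y = extOneToH1 K ρ y := rfl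

end Descent

end ExtOneDescent

end Literature.NumberTheory.GaloisRepresentations

end
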